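import Mathlib
import Summits.AnomalousDissipation.AnomalousDissipation.Theorems.SoloBlindResolventContinuation

/-!
# SoloBlind — Neumann–Taylor expansion of a perturbed inverse with explicit remainder (R8 (b))

In a complete normed ring with `‖1‖ = 1`: for a unit `u` with `‖u⁻¹‖ ≤ Q` and a perturbation
`‖e‖ ≤ δ`, `δ Q < 1`, the inverse of `u + e` equals the Neumann–Taylor polynomial
`∑_{n<N} (-(u⁻¹ e))ⁿ u⁻¹` up to a remainder of norm `≤ Q (δ Q)^N / (1 - δ Q)`.
With `e = (x - x₀) • s` this is the order-`N` Taylor expansion in the spectral parameter with the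
coefficients `(-u⁻¹ s)ⁿ u⁻¹` (resolvent powers) computed AT THE POINT and a rigorous remainder on the
disc `‖x - x₀‖ ≤ ρ`, `δ = ρ ‖s‖` — the engine-v1.2 continuation rule.  Also the product rule used to
continue multilinear functionals: `‖a' b' - a b‖ ≤ ‖a' - a‖ ‖b'‖ + ‖a‖ ‖b' - b‖`.
-/

namespace Summit.AnomalousDissipation.AnomalousDissipation.Theorems

namespace ResolventTaylor

variable {A : Type*} [NormedRing A] [NormOneClass A] [CompleteSpace A]

omit [NormOneClass A] in
/-- `(1 - t)⁻¹ - ∑_{n<N} tⁿ = t^N (1 - t)⁻¹` for `‖t‖ < 1`. -/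
theorem oneSub_inv_sub_geom_sum {t : A} (ht : ‖t‖ < 1) (N : ℕ) :
    (↑(Units.oneSub t ht)⁻¹ : A) - ∑ n ∈ Finset.range N, t ^ n =
      t ^ N * (↑(Units.oneSub t ht)⁻¹ : A) := by
  set w : Aˣ := Units.oneSub t ht with hw
  have hwval : (w : A) = 1 - t := rfl
  have hg : (∑ n ∈ Finset.range N, t ^ n) * (w : A) = 1 - t ^ N := by
    rw [hwval]; exact geom_sum_mul_neg t N
  -- multiply by w⁻¹ on the right
  have hg' : (∑ n ∈ Finset.range N, t ^ n) = (1 - t ^ N) * (↑w⁻¹ : A) := by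
    calc (∑ n ∈ Finset.range N, t ^ n) = ((∑ n ∈ Finset.range N, t ^ n) * (w : A)) * (↑w⁻¹ : A) := by
          rw [mul_assoc, Units.mul_inv, mul_one]
      _ = (1 - t ^ N) * (↑w⁻¹ : A) := by rw [hg]
  rw [hg', sub_mul, one_mul]
  abel

/-- Norm of the geometric tail: `‖(1 - t)⁻¹ - ∑_{n<N} tⁿ‖ ≤ ‖t‖^N / (1 - ‖t‖)`. -/
theorem norm_oneSub_inv_sub_geom_sum_le {t : A} (ht : ‖t‖ < 1) (N : ℕ) :
    ‖(↑(Units.oneSub t ht)⁻¹ : A) - ∑ n ∈ Finset.range N, t ^ n‖ ≤ ‖t‖ ^ N / (1 - ‖t‖) := by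
  rw [oneSub_inv_sub_geom_sum ht N]
  have hinv : ‖(↑(Units.oneSub t ht)⁻¹ : A)‖ ≤ (1 - ‖t‖)⁻¹ := norm_oneSub_inv_le_ring ht
  have hpos : 0 < 1 - ‖t‖ := by linarith
  have hpow : ‖t ^ N‖ ≤ ‖t‖ ^ N := norm_pow_le t N
  calc ‖t ^ N * (↑(Units.oneSub t ht)⁻¹ : A)‖ ≤ ‖t ^ N‖ * ‖(↑(Units.oneSub t ht)⁻¹ : A)‖ := norm_mul_le _ _
    _ ≤ ‖t‖ ^ N * (1 - ‖t‖)⁻¹ := mul_le_mul hpow hinv (norm_nonneg _) (by positivity)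
    _ = ‖t‖ ^ N / (1 - ‖t‖) := by rw [div_eq_mul_inv]

/-- **Neumann–Taylor expansion with remainder.**  `‖u⁻¹‖ ≤ Q`, `‖e‖ ≤ δ`, `δ Q < 1`: the unit
`v = u + e` satisfies `‖v⁻¹ - ∑_{n<N} (-(u⁻¹ e))ⁿ u⁻¹‖ ≤ Q (δ Q)^N / (1 - δ Q)`. -/
theorem inv_sub_taylor_le (u : Aˣ) {e : A} {Q δ : ℝ} (hQ : ‖(↑u⁻¹ : A)‖ ≤ Q) (he : ‖e‖ ≤ δ)
    (hδ : δ * Q < 1) (N : ℕ) :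
    ∃ v : Aˣ, (v : A) = u + e ∧
      ‖(↑v⁻¹ : A) - ∑ n ∈ Finset.range N, (-((↑u⁻¹ : A) * e)) ^ n * ↑u⁻¹‖ ≤
        Q * (δ * Q) ^ N / (1 - δ * Q) := by
  have hQ0 : 0 ≤ Q := (norm_nonneg _).trans hQ
  have hδ0 : 0 ≤ δ := (norm_nonneg _).trans he
  set t : A := -((↑u⁻¹ : A) * e) with ht_def
  have htn : ‖t‖ ≤ δ * Q := by
    rw [ht_def, norm_neg]
    calc ‖(↑u⁻¹ : A) * e‖ ≤ ‖(↑u⁻¹ : A)‖ * ‖e‖ := norm_mul_le _ _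
      _ ≤ Q * δ := mul_le_mul hQ he (norm_nonneg _) hQ0
      _ = δ * Q := mul_comm _ _
  have ht1 : ‖t‖ < 1 := lt_of_le_of_lt htn hδ
  set w : Aˣ := Units.oneSub t ht1 with hw_def
  have hwval : (w : A) = 1 - t := rfl
  refine ⟨u * w, ?_, ?_⟩
  · rw [Units.val_mul, hwval, ht_def, sub_neg_eq_add, mul_add, mul_one, ← mul_assoc, Units.mul_inv,
      one_mul]
  have hinv : (↑(u * w)⁻¹ : A) = (↑w⁻¹ : A) * ↑u⁻¹ := by rw [mul_inv_rev, Units.val_mul]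
  have hsum : ∑ n ∈ Finset.range N, t ^ n * (↑u⁻¹ : A) = (∑ n ∈ Finset.range N, t ^ n) * ↑u⁻¹ :=
    (Finset.sum_mul _ _ _).symm
  rw [hinv, hsum, ← sub_mul]
  have hpos : 0 < 1 - δ * Q := by linarith
  have hpos' : 0 < 1 - ‖t‖ := by linarith
  have htail := norm_oneSub_inv_sub_geom_sum_le ht1 N
  calc ‖((↑w⁻¹ : A) - ∑ n ∈ Finset.range N, t ^ n) * ↑u⁻¹‖
      ≤ ‖(↑w⁻¹ : A) - ∑ n ∈ Finset.range N, t ^ n‖ * ‖(↑u⁻¹ : A)‖ := norm_mul_le _ _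
    _ ≤ (‖t‖ ^ N / (1 - ‖t‖)) * Q := mul_le_mul htail hQ (norm_nonneg _) (by positivity)
    _ ≤ ((δ * Q) ^ N / (1 - δ * Q)) * Q := by
        apply mul_le_mul_of_nonneg_right _ hQ0
        apply div_le_div₀ (by positivity) (pow_le_pow_left₀ (norm_nonneg _) htn N) hpos (by linarith)
    _ = Q * (δ * Q) ^ N / (1 - δ * Q) := by rw [div_mul_eq_mul_div, mul_comm]

/-- Product rule for continuing multilinear functionals: `‖a' b' - a b‖ ≤ ‖a' - a‖ ‖b'‖ + ‖a‖ ‖b' - b‖`. -/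
theorem norm_mul_sub_mul_le {B : Type*} [NonUnitalSeminormedRing B] (a a' b b' : B) :
    ‖a' * b' - a * b‖ ≤ ‖a' - a‖ * ‖b'‖ + ‖a‖ * ‖b' - b‖ := by
  have h : a' * b' - a * b = (a' - a) * b' + a * (b' - b) := by
    rw [sub_mul, mul_sub]; abel
  rw [h]
  exact (norm_add_le _ _).trans (add_le_add (norm_mul_le _ _) (norm_mul_le _ _))

omit [CompleteSpace A] in
/-- Powers: `‖a'ⁿ - aⁿ‖ ≤ n Kⁿ⁻¹ ‖a' - a‖` when `‖a‖, ‖a'‖ ≤ K` (with `‖1‖ = 1`). -/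
theorem norm_pow_sub_pow_le (a a' : A) {K : ℝ} (ha : ‖a‖ ≤ K) (ha' : ‖a'‖ ≤ K) (n : ℕ) :
    ‖a' ^ n - a ^ n‖ ≤ n * K ^ (n - 1) * ‖a' - a‖ := by
  have hK : 0 ≤ K := (norm_nonneg _).trans ha
  induction n with
  | zero => simp
  | succ m ih =>
    rw [pow_succ, pow_succ]
    have h1 := norm_mul_sub_mul_le (a ^ m) (a' ^ m) a a'
    have hpm : ‖a' ^ m‖ ≤ K ^ m := (norm_pow_le a' m).trans (pow_le_pow_left₀ (norm_nonneg _) ha' m)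
    have hpm0 : ‖a ^ m‖ ≤ K ^ m := (norm_pow_le a m).trans (pow_le_pow_left₀ (norm_nonneg _) ha m)
    calc ‖a' ^ m * a' - a ^ m * a‖ ≤ ‖a' ^ m - a ^ m‖ * ‖a'‖ + ‖a ^ m‖ * ‖a' - a‖ := h1
      _ ≤ (m * K ^ (m - 1) * ‖a' - a‖) * K + K ^ m * ‖a' - a‖ := by
          gcongr
      _ = (m * (K ^ (m - 1) * K) + K ^ m) * ‖a' - a‖ := by ring
      _ ≤ ((m + 1 : ℕ) * K ^ m) * ‖a' - a‖ := by
          apply mul_le_mul_of_nonneg_right _ (norm_nonneg _)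
          rcases Nat.eq_zero_or_pos m with hm | hm
          · subst hm; simp
          · have : K ^ (m - 1) * K = K ^ m := by
              rw [← pow_succ]; congr 1; omega
            rw [this]; push_cast; nlinarith [pow_nonneg hK m]
      _ = ↑(m + 1) * K ^ (m + 1 - 1) * ‖a' - a‖ := by simp

end ResolventTaylor

end Summit.AnomalousDissipation.AnomalousDissipation.Theorems
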